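import Literature.ModelTheory.ExponentialFields.Wilkie1989PolynomialPoints
import Literature.FieldTheory.RealClosedField.DegreeTwo
import HarnessLib

/-!
# Non-singular zeros of polynomial systems over a real closed subfield lie in it

Topic `Literature/ModelTheory/ExponentialFields`.  den Besten 2016, Lemma 2.3.4 and Corollary 2.3.6
(the base case of the proof of Wilkie's First Main Theorem, for *any* complete theory
`T ⊇ RCF` of an expansion of the real field): if `k ⊆ K` are models — hence real closed ordered
fields, `k` an ordered subfield of `K` — and `Q ∈ K^r` is a non-singular zero of a square system
`g₁, …, g_r ∈ k[x₁, …, x_r]`, then every coordinate of `Q` is algebraic over `k` (Lemma 2.3.4)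
and therefore lies in `k` (Corollary 2.3.6: "`k` is relatively algebraically closed in `K`",
`k` being real closed and `K` ordered).  `Wilkie1989PolynomialPoints.lean` proves this for the
models of `T_exp` (Wilkie 1989, §6, `P_{0,s}`), with the algebraicity half
(`isAlgebraic_of_isNonsingularZero`) already in full generality; this file supplies the other
half for **arbitrary real closed ordered fields** and assembles the general statement:

* `RealClosedField.discr_lt_of_irreducible` — over a real closed field an irreducible monic
  quadratic `X² + bX + c` has `b²/4 < c`;
* `RealClosedField.mem_range_of_isAlgebraic` — **a real closed ordered field `k` is relatively
  algebraically closed in every ordered field `K` into which it embeds by a strictly monotone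
  ring homomorphism `f`**: an element of `K` algebraic over `k` lies in `f(k)`;
* `RealClosedField.exists_comp_eq_of_isNonsingularZero` — **den Besten, Corollary 2.3.6 for real
  closed fields**: a non-singular zero in `K^r` of a square polynomial system over `k` lies in
  `f(k)^r`.

By `RealExpansionModels.lean` (abstract models of `Th(ℝ | L')` are real closed in their
ordered-ring reduct) this applies verbatim to the models `k ⊆ K` of `T_{exp↾}`, `T_e`, `T_{Pf↾}`.
Nothing here is a named fact.

## References

* M. den Besten, *Wilkie's Theorem and the Uniform Real Schanuel Conjecture*, MSc thesis,
  Utrecht 2016: Lemma 2.3.4, Lemma 2.3.5, Corollary 2.3.6. [DenBesten2016]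
* A. J. Wilkie, *On the theory of the real exponential field*, Illinois J. Math. 33 (1989),
  §6, p. 403 (`P_{0,s}`). [Wilkie1989]
* J. Bochnak, M. Coste, M.-F. Roy, *Real Algebraic Geometry* (1998), §1.2 (real closed fields).
  [folklore]
-/

noncomputable section

open Polynomial

namespace Literature.ModelTheory.ExponentialFields

namespace RealClosedField

variable {k : Type*} [Field k] [LinearOrder k] [IsStrictOrderedRing k] [IsRealClosed k]
variable {K : Type*} [Field K] [LinearOrder K] [IsStrictOrderedRing K]

/-- Over a real closed field, a monic irreducible quadratic `X² + bX + c` has `b²/4 < c`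
(otherwise `-b/2 + √(b²/4 - c)` is a root). [folklore] -/
theorem discr_lt_of_irreducible {b c : k} (hm : Irreducible (X ^ 2 + C b * X + C c)) :
    b ^ 2 / 4 < c := by
  by_contra hle
  rw [not_lt] at hle
  obtain ⟨s, -, hs⟩ :=
    Literature.FieldTheory.RealClosedField.exists_nonneg_mul_self_eq (sub_nonneg.2 hle)
  have hroot : (X ^ 2 + C b * X + C c).IsRoot (-b / 2 + s) := by
    simp only [IsRoot.def, eval_add, eval_pow, eval_X, eval_mul, eval_C]
    linear_combination hs
  have h1 := degree_eq_one_of_irreducible_of_root hm hroot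
  have h2 : (X ^ 2 + C b * X + C c).degree = 2 := by
    compute_degree!
  rw [h2] at h1
  exact absurd h1 (by decide)

/-- **A real closed ordered field is relatively algebraically closed in every ordered field over
it** (den Besten 2016, proof of Corollary 2.3.6; Bochnak–Coste–Roy, §1.2): if `f : k → K` is a
strictly monotone ring homomorphism into an ordered field and `a ∈ K` is annihilated by a
nonzero polynomial over `k`, then `a ∈ f(k)` — the minimal polynomial has degree `≤ 2`
(`natDegree_le_two_of_irreducible`), and an irreducible quadratic over `k` has no root in the
ordered field `K`. [cite: DenBesten2016, Corollary 2.3.6] -/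
theorem mem_range_of_isAlgebraic (f : k →+* K) (hf : StrictMono f) {a : K} {p : k[X]}
    (hp0 : p ≠ 0) (hpa : p.eval₂ f a = 0) : a ∈ Set.range f := by
  letI : Algebra k K := f.toAlgebra
  have hφ : ∀ x : k, algebraMap k K x = f x := fun x => rfl
  have ha : IsAlgebraic k a := ⟨p, hp0, hpa⟩
  have hint : IsIntegral k a := ha.isIntegral
  have hirr := minpoly.irreducible hint
  have hmo := minpoly.monic hint
  have hdeg := Literature.FieldTheory.RealClosedField.natDegree_le_two_of_irreducible hirr
  have haev : aeval a (minpoly k a) = 0 := minpoly.aeval k a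
  rcases Nat.lt_or_ge (minpoly k a).natDegree 2 with hlt | hge
  · -- degree `1`: `minpoly = X + C r`, so `a = f (-r)`
    have hpos := minpoly.natDegree_pos hint
    have h1 : IsMonicOfDegree (minpoly k a) 1 := ⟨by omega, hmo⟩
    obtain ⟨r, hr⟩ := isMonicOfDegree_one_iff.1 h1
    rw [hr, aeval_def] at haev
    simp only [eval₂_add, eval₂_X, eval₂_C, hφ] at haev
    exact ⟨-r, by rw [map_neg]; linear_combination -haev⟩
  · -- degree `2`: `minpoly = X² + C b X + C c` with `b²/4 < c`: no root in the ordered field `K`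
    exfalso
    have h2 : IsMonicOfDegree (minpoly k a) 2 := ⟨le_antisymm hdeg hge, hmo⟩
    obtain ⟨b, c, hbc⟩ := isMonicOfDegree_two_iff.1 h2
    have hdisc : b ^ 2 / 4 < c := discr_lt_of_irreducible (hbc ▸ hirr)
    rw [hbc, aeval_def] at haev
    simp only [eval₂_add, eval₂_mul, eval₂_pow, eval₂_X, eval₂_C, hφ] at haev
    have hK : f (b ^ 2 / 4) < f c := hf hdisc
    have hK' : f (b ^ 2 / 4) = f b ^ 2 / 4 := by
      rw [map_div₀, map_pow, map_ofNat]
    rw [hK'] at hK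
    nlinarith [sq_nonneg (a + f b / 2)]

/-- **den Besten 2016, Corollary 2.3.6, for real closed ordered fields** (Wilkie 1989, §6,
`P_{0,s}`): let `f : k → K` be a strictly monotone ring homomorphism from a real closed ordered
field into an ordered field, and let `Q ∈ K^r` be a common zero of polynomials
`g₁, …, g_r ∈ k[x₁, …, x_r]` with `det (∂gᵢ/∂xⱼ)(Q) ≠ 0`; then `Q ∈ f(k)^r` (coordinates
algebraic by `isAlgebraic_of_isNonsingularZero`, Lemma 2.3.4; then relatively algebraically
closed). [cite: DenBesten2016, Corollary 2.3.6] -/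
theorem exists_comp_eq_of_isNonsingularZero (f : k →+* K) (hf : StrictMono f) {r : ℕ}
    (g : Fin r → MvPolynomial (Fin r) k) (Q : Fin r → K)
    (hzero : ∀ i, MvPolynomial.eval₂ f Q (g i) = 0)
    (hdet : (Matrix.of fun i j => MvPolynomial.eval₂ f Q (MvPolynomial.pderiv j (g i))).det ≠ 0) :
    ∃ P : Fin r → k, f ∘ P = Q := by
  letI : Algebra k K := f.toAlgebra
  have halg : ∀ j, IsAlgebraic k (Q j) :=
    isAlgebraic_of_isNonsingularZero g Q hzero hdet
  have hmem : ∀ j, Q j ∈ Set.range f := fun j => by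
    obtain ⟨p, hp0, hpa⟩ := halg j
    exact mem_range_of_isAlgebraic f hf hp0 hpa
  choose P hP using hmem
  exact ⟨P, funext hP⟩

end RealClosedField

end Literature.ModelTheory.ExponentialFields
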